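import Mathlib
import Summits.CriticalPhenomena.PercolationContinuityZ3.Theorems.PercNearOneGluingNoHeavyLowerTailOrderedDifferencesAlmostDisjoint
import Summits.CriticalPhenomena.PercolationContinuityZ3.Theorems.PercNearOneGluingNoHeavyLowerTailOrderedDifferencesProxy

/-!
# 2-chain periodicity and the pencil theorem over every field for GRAPHS (families of 2-element sets)

Helper file for crux `stmt-CriticalPhenomena-4575` (`NoHeavyLowerTail`, route `PercNearOneGluingNoHeavy`),
new-inequality factory seat `prim-ineq-gen-3` (gen 23).  Everything here is PROVED; no definitions.

Notation (memo `run/shared/lean/prim/prim-ineq-gen-3/CONJECTURE-P2.md`): `D = 𝒜 \\ 𝒜`, `Z C E = [E ⊆ C]`,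
`Y C E = [E ∩ C = ∅]`; P2 ("2-chain periodicity"): `λ Z = μ Y`, `μ Z = ν Y` on `D` force `λ = ν`.  P2 is conjectured for
every family; it implies the Marica–Schönheim PENCIL theorem over every field (`linearIndependent_pencil_of_twoChain`).

* `certificate_of_card_two` — every edge `A = {u, v}` of a graph (a family of 2-element sets) has a reciprocal
  certificate.  Five shapes, by cases on whether `u`, `v` are met by other edges and whether some edge misses `A`:
  four are two-sided interval certificates (`certificate_of_interval`, `certificate_of_interval_proxy` of the Proxy
  file: `(e_A, e_∅ - e_u - e_v + e_A)`, `(e_u, e_∅ - e_u)`, `(e_A, e_∅ - e_A)` via the proxy `{u}, {v} ↦ A`, and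
  `(e_∅, e_∅)` for a single edge), the fifth — an edge met by every other edge, at exactly one endpoint — is the
  anti-balanced pair `p = e_u + e_v - e_∅`, `q = -p`.
* `twoChain_of_card_two` — ★ hence P2 holds for every graph (over any field); graphs are NOT covered by gen 22's
  almost-disjoint theorem (which needs `3 ≤ #A`) nor by the union-closed, intersection-closed, framed or down-closed classes.
* `linearIndependent_pencil_of_card_two` — the pencil rows `[E ⊆ C] + t [E ∩ C = ∅]` of a graph over its difference
  family are independent for every `t` with `t * t ≠ 1`, over every field.
(prim-ineq-gen-3 gen 23, 2026-08-24.)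
-/

namespace Summit.CriticalPhenomena.PercolationContinuityZ3.Theorems

namespace OrderedDifferences

open Finset
open scoped FinsetFamily

variable {α : Type*} [DecidableEq α] {K : Type*} [Field K]

/-! ## Graphs: families of 2-element sets -/

/-- **Reciprocal certificates for the edges of a graph.**  In a family of 2-element sets every member has a reciprocal
certificate.  (Cases on whether the two endpoints are met by other members and whether a disjoint member exists; four of
the five shapes are two-sided interval certificates, the fifth — an edge met by every other member at exactly one
endpoint — is `p = e_{u} + e_{v} - e_∅`, `q = -p`.) -/
theorem certificate_of_card_two (ℬ : Finset (Finset α)) (h2 : ∀ C ∈ ℬ, #C = 2) (A : Finset α) (hA : A ∈ ℬ) :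
    ∃ p q : Finset α → K,
      (∀ C ∈ ℬ, ∑ W ∈ ℬ \\ ℬ, p W * (if W ⊆ C then (1 : K) else 0) = if C = A then 1 else 0) ∧
      (∀ C ∈ ℬ, ∑ W ∈ ℬ \\ ℬ, q W * (if Disjoint W C then (1 : K) else 0) = if C = A then 1 else 0) ∧
      (∀ C ∈ ℬ, ∑ W ∈ ℬ \\ ℬ, p W * (if Disjoint W C then (1 : K) else 0) =
        ∑ W ∈ ℬ \\ ℬ, q W * (if W ⊆ C then (1 : K) else 0)) := by
  classical
  obtain ⟨u, v, huv, rfl⟩ := card_eq_two.mp (h2 A hA)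
  -- basic facts about the other members
  have hnsub : ∀ C ∈ ℬ, C ≠ {u, v} → ¬ ({u, v} : Finset α) ⊆ C := by
    intro C hC hCA hsub
    exact hCA (eq_of_subset_of_card_le hsub (by rw [h2 C hC, h2 _ hA])).symm
  have h0 : (∅ : Finset α) ∈ ℬ \\ ℬ := mem_diffs.mpr ⟨{u, v}, hA, {u, v}, hA, by simp⟩
  -- the singleton columns
  have hcolu : (∃ C ∈ ℬ, C ≠ {u, v} ∧ v ∈ C) → ({u} : Finset α) ∈ ℬ \\ ℬ := by
    rintro ⟨C, hC, hCA, hvC⟩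
    have huC : u ∉ C := fun huC => hnsub C hC hCA (insert_subset huC (singleton_subset_iff.mpr hvC))
    refine mem_diffs.mpr ⟨{u, v}, hA, C, hC, ?_⟩
    ext x
    simp only [mem_sdiff, mem_insert, mem_singleton]
    constructor
    · rintro ⟨hx | hx, hxC⟩
      · exact hx
      · exact absurd (hx ▸ hvC) hxC
    · rintro rfl
      exact ⟨Or.inl rfl, huC⟩
  have hcolv : (∃ C ∈ ℬ, C ≠ {u, v} ∧ u ∈ C) → ({v} : Finset α) ∈ ℬ \\ ℬ := by
    rintro ⟨C, hC, hCA, huC⟩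
    have hvC : v ∉ C := fun hvC => hnsub C hC hCA (insert_subset huC (singleton_subset_iff.mpr hvC))
    refine mem_diffs.mpr ⟨{u, v}, hA, C, hC, ?_⟩
    ext x
    simp only [mem_sdiff, mem_insert, mem_singleton]
    constructor
    · rintro ⟨hx | hx, hxC⟩
      · exact absurd (hx ▸ huC) hxC
      · exact hx
    · rintro rfl
      exact ⟨Or.inr rfl, hvC⟩
  by_cases tu : ∃ C ∈ ℬ, C ≠ {u, v} ∧ u ∈ C
  · by_cases tv : ∃ C ∈ ℬ, C ≠ {u, v} ∧ v ∈ C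
    · -- both endpoints are touched by other members: columns `{u}`, `{v}` exist
      have hU := hcolu tv
      have hV := hcolv tu
      by_cases dp : ∃ B ∈ ℬ, Disjoint {u, v} B
      · -- and a disjoint member: the whole Boolean interval below `A` lies in `D` (gen 22's M1)
        obtain ⟨B, hB, hAB⟩ := dp
        have hAD : ({u, v} : Finset α) ∈ ℬ \\ ℬ :=
          mem_diffs.mpr ⟨{u, v}, hA, B, hB, sdiff_eq_self_of_disjoint hAB⟩
        refine certificate_of_interval ℬ {u, v} {u, v} ∅ (fun F hF => ?_) (fun G hG => ?_) (fun C hC => ?_)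
        · rw [subset_empty.mp hF, union_empty]; exact hAD
        · rw [empty_union]
          rcases subset_insert_iff.mp hG with hG'
          by_cases hu : u ∈ G
          · by_cases hv : v ∈ G
            · have : G = {u, v} := subset_antisymm hG (insert_subset hu (singleton_subset_iff.mpr hv))
              rw [this]; exact hAD
            · have : G = {u} := by
                refine subset_antisymm ?_ (singleton_subset_iff.mpr hu)
                intro x hx
                rcases mem_insert.mp (hG hx) with rfl | hx'
                · exact mem_singleton_self _
                · exact absurd (mem_singleton.mp hx' ▸ hx) hv
              rw [this]; exact hU
          · by_cases hv : v ∈ G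
            · have : G = {v} := by
                refine subset_antisymm ?_ (singleton_subset_iff.mpr hv)
                intro x hx
                rcases mem_insert.mp (hG hx) with rfl | hx'
                · exact absurd hx hu
                · exact hx'
              rw [this]; exact hV
            · have : G = ∅ := by
                refine eq_empty_of_forall_notMem fun x hx => ?_
                rcases mem_insert.mp (hG hx) with rfl | hx'
                · exact hu hx
                · exact hv (mem_singleton.mp hx' ▸ hx)
              rw [this]; exact h0
        · rw [and_iff_left (disjoint_empty_left C)]
          constructor
          · intro h
            by_contra hne
            exact hnsub C hC hne h
          · rintro rfl; exact subset_rfl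
      · -- no disjoint member: every other member meets `A` in exactly one endpoint; `p = e_u + e_v - e_∅`, `q = -p`
        have hmeet : ∀ C ∈ ℬ, C ≠ {u, v} → (u ∈ C ∧ v ∉ C) ∨ (u ∉ C ∧ v ∈ C) := by
          intro C hC hCA
          have hnd : ¬ Disjoint {u, v} C := fun h => dp ⟨C, hC, h⟩
          by_cases hu : u ∈ C
          · by_cases hv : v ∈ C
            · exact absurd (insert_subset hu (singleton_subset_iff.mpr hv)) (hnsub C hC hCA)
            · exact Or.inl ⟨hu, hv⟩
          · by_cases hv : v ∈ C
            · exact Or.inr ⟨hu, hv⟩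
            · exfalso; apply hnd
              rw [disjoint_insert_left, disjoint_singleton_left]
              exact ⟨hu, hv⟩
        let p : Finset α → K := fun W =>
          (if W = {u} then (1 : K) else 0) + (if W = {v} then (1 : K) else 0) - (if W = ∅ then (1 : K) else 0)
        have hsum : ∀ g : Finset α → K, ∑ W ∈ ℬ \\ ℬ, p W * g W = g {u} + g {v} - g ∅ := by
          intro g
          simp only [p, add_mul, sub_mul, sum_add_distrib, sum_sub_distrib, ite_mul, one_mul, zero_mul]
          rw [sum_ite_eq' (ℬ \\ ℬ) {u}, if_pos hU, sum_ite_eq' (ℬ \\ ℬ) {v}, if_pos hV,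
            sum_ite_eq' (ℬ \\ ℬ) ∅, if_pos h0]
        have hsum' : ∀ g : Finset α → K, ∑ W ∈ ℬ \\ ℬ, (-p W) * g W = -(g {u} + g {v} - g ∅) := by
          intro g
          rw [← hsum g, ← sum_neg_distrib]
          exact sum_congr rfl fun W _ => by ring
        have hZ : ∀ C ∈ ℬ, ((if ({u} : Finset α) ⊆ C then (1 : K) else 0) + (if ({v} : Finset α) ⊆ C then (1 : K) else 0)
            - (if (∅ : Finset α) ⊆ C then (1 : K) else 0)) = if C = {u, v} then 1 else 0 := by
          intro C hC
          simp only [singleton_subset_iff, empty_subset, if_true]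
          by_cases hCA : C = {u, v}
          · subst hCA
            rw [if_pos (mem_insert_self _ _), if_pos (mem_insert_of_mem (mem_singleton_self _)), if_pos rfl]; ring
          · rw [if_neg hCA]
            rcases hmeet C hC hCA with ⟨hu, hv⟩ | ⟨hu, hv⟩
            · rw [if_pos hu, if_neg hv]; ring
            · rw [if_neg hu, if_pos hv]; ring
        have hY : ∀ C ∈ ℬ, ((if Disjoint ({u} : Finset α) C then (1 : K) else 0) +
            (if Disjoint ({v} : Finset α) C then (1 : K) else 0) - (if Disjoint (∅ : Finset α) C then (1 : K) else 0)) =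
            if C = {u, v} then -1 else 0 := by
          intro C hC
          simp only [disjoint_singleton_left, disjoint_empty_left, if_true]
          by_cases hCA : C = {u, v}
          · subst hCA
            rw [if_neg (not_not.mpr (mem_insert_self _ _)),
              if_neg (not_not.mpr (mem_insert_of_mem (mem_singleton_self _))), if_pos rfl]; ring
          · rw [if_neg hCA]
            rcases hmeet C hC hCA with ⟨hu, hv⟩ | ⟨hu, hv⟩
            · rw [if_neg (not_not.mpr hu), if_pos hv]; ring
            · rw [if_pos hu, if_neg (not_not.mpr hv)]; ring
        refine ⟨p, fun W => -p W, fun C hC => ?_, fun C hC => ?_, fun C hC => ?_⟩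
        · rw [hsum]; exact hZ C hC
        · rw [hsum', hY C hC]
          by_cases hCA : C = {u, v}
          · rw [if_pos hCA, if_pos hCA]; ring
          · rw [if_neg hCA, if_neg hCA]; ring
        · rw [hsum, hsum', hY C hC, hZ C hC]
          by_cases hCA : C = {u, v}
          · simp [hCA]
          · simp [hCA]
    · -- `u` touched, `v` untouched: the column `{v}` has the unique container `A`
      have hV := hcolv tu
      refine certificate_of_interval ℬ {u, v} {v} ∅ (fun F hF => ?_) (fun G hG => ?_) (fun C hC => ?_)
      · rw [subset_empty.mp hF, union_empty]; exact hV
      · rw [empty_union]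
        rcases subset_singleton_iff.mp hG with rfl | rfl
        · exact h0
        · exact hV
      · rw [and_iff_left (disjoint_empty_left C), singleton_subset_iff]
        constructor
        · intro hvC
          by_contra hne
          exact tv ⟨C, hC, hne, hvC⟩
        · rintro rfl; exact mem_insert_of_mem (mem_singleton_self _)
  · by_cases tv : ∃ C ∈ ℬ, C ≠ {u, v} ∧ v ∈ C
    · -- `v` touched, `u` untouched
      have hU := hcolu tv
      refine certificate_of_interval ℬ {u, v} {u} ∅ (fun F hF => ?_) (fun G hG => ?_) (fun C hC => ?_)
      · rw [subset_empty.mp hF, union_empty]; exact hU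
      · rw [empty_union]
        rcases subset_singleton_iff.mp hG with rfl | rfl
        · exact h0
        · exact hU
      · rw [and_iff_left (disjoint_empty_left C), singleton_subset_iff]
        constructor
        · intro huC
          by_contra hne
          exact tu ⟨C, hC, hne, huC⟩
        · rintro rfl; exact mem_insert_self _ _
    · -- `A` is an isolated edge: every other member is disjoint from it
      have hiso : ∀ C ∈ ℬ, C ≠ {u, v} → Disjoint {u, v} C := by
        intro C hC hCA
        rw [disjoint_insert_left, disjoint_singleton_left]
        exact ⟨fun h => tu ⟨C, hC, hCA, h⟩, fun h => tv ⟨C, hC, hCA, h⟩⟩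
      by_cases dp : ∃ B ∈ ℬ, Disjoint {u, v} B
      · -- proxies: every nonempty subset of `A` has the type of `A`
        obtain ⟨B, hB, hAB⟩ := dp
        have hAD : ({u, v} : Finset α) ∈ ℬ \\ ℬ :=
          mem_diffs.mpr ⟨{u, v}, hA, B, hB, sdiff_eq_self_of_disjoint hAB⟩
        have hne : ({u, v} : Finset α) ≠ ∅ := (insert_nonempty _ _).ne_empty
        refine certificate_of_interval_proxy ℬ {u, v} {u, v} ∅ (fun G => if G = ∅ then ∅ else {u, v})
          (fun F hF => ?_) (fun G hG => ?_) (fun C hC => ?_)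
        · rw [subset_empty.mp hF, union_empty, if_neg hne]
          exact ⟨hAD, fun C _ => Iff.rfl, fun C _ => Iff.rfl⟩
        · rw [empty_union]
          by_cases hG0 : G = ∅
          · subst hG0; rw [if_pos rfl]; exact ⟨h0, fun C _ => Iff.rfl, fun C _ => Iff.rfl⟩
          · rw [if_neg hG0]
            obtain ⟨x, hx⟩ := nonempty_iff_ne_empty.mpr hG0
            refine ⟨hAD, fun C hC => ?_, fun C hC => ?_⟩
            · by_cases hCA : C = {u, v}
              · subst hCA; exact ⟨fun _ => hG, fun _ => subset_rfl⟩
              · have hd := hiso C hC hCA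
                constructor
                · intro h; exact absurd h (hnsub C hC hCA)
                · intro h; exact absurd (h hx) (disjoint_left.mp hd (hG hx))
            · by_cases hCA : C = {u, v}
              · subst hCA
                constructor
                · intro h; exact absurd h (fun h' => hne (disjoint_self.mp h'))
                · intro h; exact absurd (hG hx) (disjoint_left.mp h hx)
              · have hd := hiso C hC hCA
                exact ⟨fun _ => hd.mono_left hG, fun _ => hd⟩
        · rw [and_iff_left (disjoint_empty_left C)]
          constructor
          · intro h
            by_contra hne'
            exact hnsub C hC hne' h
          · rintro rfl; exact subset_rfl
      · -- `ℬ = {A}`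
        have honly : ∀ C ∈ ℬ, C = {u, v} := by
          intro C hC
          by_contra hCA
          exact dp ⟨C, hC, hiso C hC hCA⟩
        refine certificate_of_interval ℬ {u, v} ∅ ∅ (fun F hF => ?_) (fun G hG => ?_) (fun C hC => ?_)
        · rw [subset_empty.mp hF, union_empty]; exact h0
        · rw [subset_empty.mp hG, union_empty]; exact h0
        · simp only [empty_subset, disjoint_empty_left, and_self, true_iff]
          exact honly C hC

/-- **P2 for graphs.**  If every member of `𝒜` has exactly two elements (the edge set of a simple graph), then 2-chain
periodicity holds over any field: `λ Z = μ Y` and `μ Z = ν Y` on `𝒜 \\ 𝒜` force `λ = ν`. -/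
theorem twoChain_of_card_two (𝒜 : Finset (Finset α)) (h2 : ∀ A ∈ 𝒜, #A = 2)
    (l m n : ↥𝒜 → K)
    (hr1 : ∀ E ∈ 𝒜 \\ 𝒜, ∑ A : 𝒜, l A * (if E ⊆ (A : Finset α) then (1 : K) else 0) =
        ∑ A : 𝒜, m A * (if Disjoint E (A : Finset α) then (1 : K) else 0))
    (hr2 : ∀ E ∈ 𝒜 \\ 𝒜, ∑ A : 𝒜, m A * (if E ⊆ (A : Finset α) then (1 : K) else 0) =
        ∑ A : 𝒜, n A * (if Disjoint E (A : Finset α) then (1 : K) else 0)) :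
    l = n :=
  twoChain_of_certificates 𝒜 (fun A hA => certificate_of_card_two 𝒜 h2 A hA) l m n hr1 hr2

/-- **The pencil theorem over every field for graphs.**  If every member of `𝒜` has exactly two elements then the pencil
rows `C ↦ (E ↦ [E ⊆ C] + t [E ∩ C = ∅])` over `𝒜 \\ 𝒜` are linearly independent for every `t` with `t * t ≠ 1`. -/
theorem linearIndependent_pencil_of_card_two (𝒜 : Finset (Finset α)) (h2 : ∀ A ∈ 𝒜, #A = 2)
    {t : K} (ht : t * t ≠ 1) :
    LinearIndependent K (fun A : 𝒜 => fun E : (𝒜 \\ 𝒜 : Finset (Finset α)) =>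
      (if (E : Finset α) ⊆ (A : Finset α) then (1 : K) else 0) +
        t * (if Disjoint (E : Finset α) (A : Finset α) then (1 : K) else 0)) :=
  linearIndependent_pencil_of_twoChain 𝒜 (fun l m n h1' h2' => twoChain_of_card_two 𝒜 h2 l m n h1' h2') ht

end OrderedDifferences

end Summit.CriticalPhenomena.PercolationContinuityZ3.Theorems
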